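import Summits.Langlands.Langlands.Theses.IrreducibilityBySelfDuality
import Literature.NumberTheory.Automorphic.IdeleNormDetGL
import Literature.NumberTheory.GaloisRepresentations.WeakAbelianDirectSummandCyclotomicProofs
import Literature.NumberTheory.GaloisRepresentations.HeckeCharacterNormCharacter
import Literature.NumberTheory.GaloisRepresentations.AlgebraicHeckeCharacterGrossencharakterProofs

/-!
# `RegularAdjointLiftCM` — negative lane: the cube-root stub needs its divisibility hypothesis

Refuter-side (drefute) support for the crux `RegularAdjointLiftCM` (item stmt-Langlands-13617, route
`route-Langlands-IrreducibilityBySelfDuality`), line `nu-cubed-central-character`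
(`Cruxes/RegularAdjointLiftCM/Lines/nu-cubed-central-character.lean`).  No statement of the route is
proved or refuted here.

The line's stub `stub_cubeRootAlgebraic` reads: if `χ ^ 3 = ω`, `ω` has infinity type `(p, q)` and
`3 ∣ p_w + q_w` at every infinite place `w`, then `χ` is algebraic.  This file shows, kernel-checked,
that the divisibility hypothesis is LOAD-BEARING: with it dropped the statement
(`cubeRootAlgebraic_false_without_dvd`, the stub's text with `3 ∣ p w + q w` deleted) is false.  Witness over `K = ℚ`: the norm-power Hecke character
`χ = ‖·‖^{1/3}` (`exists_heckeCharacter_ideleNorm_cpow`) is a cube root of the norm character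
`‖·‖` (`HeckeCharacter.normCharacter`), which is algebraic (`isAlgebraic_normCharacter`, type
`p + q = -1` at the real place), but `χ` is not algebraic: an infinity type `(p', q')` of `χ` would give,
at the totally positive principal infinite idele `(2)_∞`
(`HasInfinityType.apply_globalToInfiniteUnits_eq`), `2^{1/3} = 2^{-(p' + q')}`, i.e. `2 = 2^{3m}` with
`m ∈ ℤ`.

* `not_isAlgebraic_of_apply_eq_ideleNorm_cpow_third` — `‖·‖^{1/3}` on `𝕀_ℚ` is not algebraic;
* `exists_cubeRoot_normCharacter_not_isAlgebraic` — `‖·‖` over `ℚ` has a non-algebraic Hecke cube root;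
* `cubeRootAlgebraic_false_without_dvd` — the stub minus its divisibility hypothesis is false.
-/

open scoped BigOperators ComplexConjugate
open NumberField
open Literature.NumberTheory.Automorphic
open Literature.NumberTheory.GaloisRepresentations

set_option linter.dupNamespace false

noncomputable section

namespace Summit.Langlands.Langlands.Theorems.RegularAdjointLiftCM.Negative

/-- **`‖·‖^{1/3}` is not an algebraic Hecke character of `ℚ`.**  If `χ(x) = ‖x‖^{1/3}` for every idele
`x` of `ℚ`, then `χ` has no infinity type: evaluating a putative type `(p, q)` at the (totally positive)
principal infinite idele of `2` gives `2^{1/3} = 2^{-p_∞} · 2^{-q_∞}`, whose cube `2 = 2^{3m}` is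
impossible for an integer `m`.  (Weil 1956: `‖·‖^s` is of type `A₀` iff `s ∈ ℤ`.) [folklore] -/
theorem not_isAlgebraic_of_apply_eq_ideleNorm_cpow_third {χ : HeckeCharacter ℚ}
    (hχ : ∀ x : ideleGroup ℚ, ((χ x : ℂˣ) : ℂ) = (ideleNorm x : ℂ) ^ (1 / 3 : ℂ)) :
    ¬ χ.IsAlgebraic := by
  intro halg
  obtain ⟨p, q, h⟩ := (HeckeCharacter.isAlgebraic_iff_exists_hasInfinityType χ).1 halg
  -- evaluate at the principal infinite idele of `2`
  set k : ℚˣ := Units.mk0 (2 : ℚ) two_ne_zero with hk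
  have hk2 : (k : ℚ) = 2 := by rw [hk, Units.val_mk0]
  have hpos : ∀ φ : ℚ →+* ℝ, 0 < φ (k : ℚ) := fun φ => by rw [hk2, map_ofNat]; norm_num
  have key := h.apply_globalToInfiniteUnits_eq hpos
  -- the left-hand side is `2 ^ (1/3)`
  have hw : ∀ w : InfinitePlace ℚ, w.IsReal := fun w => by
    rw [Subsingleton.elim w Rat.infinitePlace]; exact Rat.isReal_infinitePlace
  have hcoord : ∀ w : InfinitePlace ℚ, ‖(globalToInfiniteUnits ℚ k : InfiniteAdeleRing ℚ) w‖ = 2 := by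
    intro w
    have h1 : InfinitePlace.Completion.extensionEmbedding w
        ((globalToInfiniteUnits ℚ k : InfiniteAdeleRing ℚ) w) = w.embedding (k : ℚ) := by
      rw [val_globalToInfiniteUnits, InfiniteAdeleRing.algebraMap_apply]
      exact InfinitePlace.Completion.extensionEmbedding_coe w (WithAbs.toAbs w.1 (k : ℚ))
    rw [← (InfinitePlace.Completion.isometry_extensionEmbedding w).norm_map_of_map_zero (map_zero _),
      h1, hk2, map_ofNat]
    exact Complex.norm_two
  have hnorm : ideleNorm (infiniteIdeles ℚ (globalToInfiniteUnits ℚ k)) = 2 := by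
    rw [HeckeCharacter.ideleNorm_infiniteIdeles, Fintype.prod_unique, hcoord, InfinitePlace.mult,
      if_pos (hw _), pow_one]
  rw [hχ, hnorm, Complex.ofReal_ofNat] at key
  -- the right-hand side is `2 ^ (-p) * 2 ^ (-q)` at the unique infinite place
  rw [Fintype.prod_unique, hk2, map_ofNat, map_ofNat, ← zpow_add₀ (two_ne_zero : (2 : ℂ) ≠ 0)] at key
  set m : ℤ := -p default + -q default with hm
  -- cube both sides
  have hcube : ((2 : ℂ) ^ (1 / 3 : ℂ)) ^ 3 = ((2 : ℂ) ^ m) ^ 3 := by rw [key]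
  rw [← Complex.cpow_nat_mul, ← zpow_natCast ((2 : ℂ) ^ m) 3, ← zpow_mul] at hcube
  have h13 : ((3 : ℕ) : ℂ) * (1 / 3 : ℂ) = 1 := by push_cast; norm_num
  rw [h13, Complex.cpow_one] at hcube
  -- `2 = 2 ^ (3m)` in `ℝ`
  have hreal : (2 : ℝ) ^ (1 : ℤ) = (2 : ℝ) ^ (m * 3) := by
    rw [zpow_one]
    have h2 : ((2 : ℝ) : ℂ) = (((2 : ℝ) ^ (m * 3) : ℝ) : ℂ) := by
      rw [Complex.ofReal_zpow]
      push_cast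
      exact hcube
    exact_mod_cast h2
  have hinj := zpow_right_injective₀ (by norm_num : (0 : ℝ) < 2) (by norm_num : (2 : ℝ) ≠ 1) hreal
  omega

/-- **The norm character of `ℚ` has a Hecke cube root which is not algebraic**, namely `‖·‖^{1/3}`
(`exists_heckeCharacter_ideleNorm_cpow`). [folklore] -/
theorem exists_cubeRoot_normCharacter_not_isAlgebraic :
    ∃ χ : HeckeCharacter ℚ, χ ^ 3 = HeckeCharacter.normCharacter ℚ ∧ ¬ χ.IsAlgebraic := by
  obtain ⟨χ, hχ⟩ := exists_heckeCharacter_ideleNorm_cpow ℚ (1 / 3 : ℂ)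
  refine ⟨χ, HeckeCharacter.ext fun x => Units.ext ?_, not_isAlgebraic_of_apply_eq_ideleNorm_cpow_third hχ⟩
  rw [HeckeCharacter.pow_apply, Units.val_pow_eq_pow_val, hχ x, HeckeCharacter.normCharacter_apply,
    ← Complex.cpow_nat_mul]
  have h13 : ((3 : ℕ) : ℂ) * (1 / 3 : ℂ) = 1 := by push_cast; norm_num
  rw [h13, Complex.cpow_one]

/-- **The divisibility hypothesis of `stub_cubeRootAlgebraic` cannot be dropped**: a Hecke cube root of
an algebraic Hecke character need not be algebraic (`χ = ‖·‖^{1/3}`, `ω = ‖·‖` over `ℚ`, of type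
`p + q = -1 ≢ 0 (mod 3)` at the real place). [folklore] -/
theorem cubeRootAlgebraic_false_without_dvd :
    ¬ ∀ (K : Type) [Field K] [NumberField K] (χ ω : HeckeCharacter K) (p q : InfinitePlace K → ℤ),
        χ ^ 3 = ω → ω.HasInfinityType p q → χ.IsAlgebraic := by
  intro h
  obtain ⟨χ, hχ3, hχ⟩ := exists_cubeRoot_normCharacter_not_isAlgebraic
  obtain ⟨p, q, hω⟩ := (HeckeCharacter.isAlgebraic_iff_exists_hasInfinityType _).1
    (HeckeCharacter.isAlgebraic_normCharacter (K := ℚ))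
  exact hχ (h ℚ χ _ p q hχ3 hω)

end Summit.Langlands.Langlands.Theorems.RegularAdjointLiftCM.Negative

end
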